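import Literature.NumberTheory.Transcendental.FeldmanDeltaPolynomials
import Literature.NumberTheory.Transcendental.ExpOneTranscendenceMeasureMatrix
import Literature.NumberTheory.Transcendental.ExpOneTranscendenceMeasureDeterminant
import Literature.NumberTheory.Transcendental.ExpOneTranscendenceMeasureLiouville
import Literature.NumberTheory.Transcendental.ExpAlgebraicTranscendenceMeasureMatrix
import HarnessLib

/-!
# Transcendence measure for `π` (Nesterenko–Waldschmidt 1996, Theorem 2) — the core of §6
# for `θ = πi`, `α = -1`, with Fel'dman's polynomials `Δ(z; τ, H)`

Sibling PROOFS file of `PiTranscendenceMeasure.lean` (the named fact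
`Literature.NumberTheory.Transcendental.NesterenkoWaldschmidt1996_thm_2_2`). Everything here is
PROVED; the three `def`s (`NWPi.delta`, `NWPi.hasseZ`, `NWPi.pZ`) are abbreviations for data of the
proof, not named facts.

Yu. V. Nesterenko, M. Waldschmidt, *On the approximation of the values of exponential function and
logarithm by algebraic numbers*, Mat. Zapiski 2 (1996) 23–42 (arXiv:math/0002047). Theorem 2 there
is deduced (p. 2) from the Main Theorem (Theorem 1) at `θ = πi`, `α = e^θ = -1`, `β = iξ`
(`ξ` an algebraic approximation of `π`). This file carries out steps a)–d) of the proof of the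
Main Theorem (§6) in exactly this situation, with the basis of §4,

  `f_{τ,t}(z) = Δ(z; τ, H) e^{θ t z}`,  `0 ≤ τ ≤ T`, `|t| ≤ T₁`,  `Δ(z; τ, H) = num_τ(z)/den_τ`

(`FeldmanDeltaPolynomials.lean`: `FeldmanDelta.num`, `FeldmanDelta.den`, Lemma 4), for ABSTRACT
parameters `H, T, T₁, S, S₁, E`; the choice of the parameters, the prime number bound
`log ν(H) ≤ 1.15 H` and the numerical verification are the next part. The general tools are the
tree's `NW1996.multiplicity_estimate` (Lemma 2), `NW1996.norm_det_interpolation_deriv_le` (Lemma 3),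
`NW1996.liouville` (Lemma 5, `n = 1`: here `α = -1 ∈ ℚ`, so only `β` is irrational and the field is
`ℚ(β)` of degree `D = deg β`), `Waldschmidt1978.det_expand` / `sum_abs_detCoeff_le` (expansion and
length of a determinant of polynomial entries) and `NW1996.exists_submatrix_det_ne_zero`.

## Contents

* `NWPi.delta τ H = C den_τ⁻¹ · num_τ ∈ ℂ[X]`, `NWPi.hasseZ τ H k s = (taylor s num_τ).coeff k ∈ ℤ`
  (so `Δ_τ^{(k)}(s) = k! hasseZ / den_τ`), `NWPi.eval_twist_pow_delta`:
  `((∂ + tβ)^σ Δ_τ)(s) = den_τ⁻¹ ∑ₖ C(σ,k) k! hasseZ(τ,k,s) (tβ)^{σ-k}` (the action of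
  `δ = ∂/∂X + βY∂/∂Y` on `Δ_τ(X) Y^t`, (6.3)).
* `NWPi.algMatrix_mulVec_eq_zero_pi` — **Lemma 6** for the basis `Δ_τ(X)Y^t` (`α, β ≠ 0`): the
  matrix `((∂ + tβ)^σ Δ_τ)(s) α^{ts}` has full column rank under condition (2.1) (the `Δ_τ` are
  linearly independent, `NWPi.eq_zero_of_sum_smul_delta_eq_zero`, and `NW1996.multiplicity_estimate`).
* `NWPi.pZ H σ τ s t k = ν(H)^σ C(σ,k) k! hasseZ t^{σ-k} / den_τ ∈ ℤ` (Lemma 4 integrality,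
  `FeldmanDelta.den_dvd_lcmUpto_pow_mul_coeff_taylor`), `NWPi.sum_abs_pZ_le` (row sums
  `≤ ν^S T₁^S S^S e^{T+H} (1+S₁/H)^T`, from (4.3)), `NWPi.scaled_entry_eq`
  (`ν^σ · a(σ,s;τ,t) = (∑ₖ pZ β^{σ-k}) (-1)^{|ts|}`).
* `NWPi.iteratedDeriv_f`, `NWPi.iteratedDeriv_f_int`, `NWPi.norm_iteratedDeriv_f_le` — (6.2) and the
  bound `|f^{(σ)}| ≤ S^S e^{T+H}(1 + R/H)^T K^S e^{KR}` on `|z| ≤ R` (`K ≥ |θ| T₁`), from (4.3);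
  `NWPi.norm_alg_sub_analytic_le` — the perturbation `a(σ,s;τ,t) − f_{τ,t}^{(σ)}(s)` is
  `≤ S^S e^{T+H}(1+S₁/H)^T T₁^S · S R^S |β − πi|`.
* `NWPi.pi_core` — **steps a)–d)**: under (2.1), the smallness `S R^S |β − πi| E^L ≤ 1` and the
  main inequality, contradiction.

## References

* [NesterenkoWaldschmidt1996] Yu. V. Nesterenko, M. Waldschmidt, Mat. Zapiski 2 (1996) 23–42
  (arXiv:math/0002047), §4 (4.1)–(4.3), §6 a)–d), (6.2), (6.3), (6.5), (6.6), Lemma 6.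
-/

noncomputable section

open Polynomial Finset
open scoped Nat

namespace Literature.NumberTheory.Transcendental

namespace NWPi

open FeldmanDelta NW1996 Complex Matrix

/-! ### The basis `Δ_τ = num_τ / den_τ` and the integer data -/

/-- `Δ_τ = Δ(X; τ, H) = num/den ∈ ℂ[X]` (Fel'dman's polynomial (4.1)). [cite: NesterenkoWaldschmidt1996, §4 (4.1)] -/
def delta (τ H : ℕ) : ℂ[X] := C ((den τ H : ℂ)⁻¹) * num ℂ τ H

/-- The integer Hasse values `A(τ,k,s) = (taylor s num_τ).coeff k = Δ_τ^{(k)}(s) den_τ / k!`.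
[cite: NesterenkoWaldschmidt1996, §4 Lemma 4] -/
def hasseZ (τ H k : ℕ) (s : ℤ) : ℤ := (taylor s (num ℤ τ H)).coeff k

/-- `hasseZ` cast to `ℂ` is the complex Taylor coefficient. [folklore] -/
theorem cast_hasseZ (τ H k : ℕ) (s : ℤ) :
    ((hasseZ τ H k s : ℤ) : ℂ) = (taylor (s : ℂ) (num ℂ τ H)).coeff k := by
  classical
  unfold hasseZ
  rcases Nat.lt_or_ge τ k with hk | hk
  · rw [coeff_taylor_num_eq_zero τ H s hk, coeff_taylor_num_eq_zero τ H (s : ℂ) hk, Int.cast_zero]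
  · rw [coeff_taylor_num τ H s hk, coeff_taylor_num τ H (s : ℂ) hk]
    push_cast
    rfl

/-- `hasseZ` cast to `ℝ` is the real Taylor coefficient at `s`. [folklore] -/
theorem cast_hasseZ_real (τ H k : ℕ) (s : ℤ) :
    ((hasseZ τ H k s : ℤ) : ℝ) = (taylor (s : ℝ) (num ℝ τ H)).coeff k := by
  classical
  unfold hasseZ
  rcases Nat.lt_or_ge τ k with hk | hk
  · rw [coeff_taylor_num_eq_zero τ H s hk, coeff_taylor_num_eq_zero τ H (s : ℝ) hk, Int.cast_zero]
  · rw [coeff_taylor_num τ H s hk, coeff_taylor_num τ H (s : ℝ) hk]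
    push_cast
    rfl

/-- `|A(τ,k,s)| ≤ (hasseDeriv k num_ℝ)(|s|)` (domination). [folklore] -/
theorem abs_hasseZ_le (τ H k : ℕ) (s : ℤ) :
    |(hasseZ τ H k s : ℝ)| ≤ (hasseDeriv k (num ℝ τ H)).eval (|(s : ℝ)|) := by
  have h := norm_hasseDeriv_num_eval_le τ H k (s : ℂ)
  rw [hasseDeriv_num_eval, ← cast_hasseZ, Complex.norm_intCast] at h
  exact_mod_cast h

/-! ### The twisted derivatives `((∂ + tβ)^σ Δ_τ)(s)` -/

/-- `((∂ + tβ)^σ Δ_τ)(s) = den_τ⁻¹ ∑ₖ C(σ,k) k! A(τ,k,s) (tβ)^{σ-k}` (the action of `δ^σ` on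
`Δ_τ(X) Y^t` at `(s, ·)`). [cite: NesterenkoWaldschmidt1996, §6 Lemma 6] -/
theorem eval_twist_pow_delta (β : ℂ) (σ τ H : ℕ) (s t : ℤ) :
    ((twist ((t : ℂ) * β) ^ σ) (delta τ H)).eval (s : ℂ) =
      ((den τ H : ℂ))⁻¹ * ∑ k ∈ range (σ + 1),
        (σ.choose k : ℂ) * (k ! : ℂ) * (hasseZ τ H k s : ℂ) * ((t : ℂ) * β) ^ (σ - k) := by
  have hlin : (twist ((t : ℂ) * β) ^ σ) (delta τ H) =
      C ((den τ H : ℂ)⁻¹) * (twist ((t : ℂ) * β) ^ σ) (num ℂ τ H) := by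
    rw [delta, ← smul_eq_C_mul, map_smul, smul_eq_C_mul]
  rw [hlin, eval_mul, eval_C]
  congr 1
  have h := twist_pow_mul ((t : ℂ) * β) (num ℂ τ H) 1 σ
  rw [mul_one] at h
  rw [h, eval_finsetSum, Finset.Nat.sum_antidiagonal_eq_sum_range_succ_mk]
  refine Finset.sum_congr rfl fun k _ => ?_
  have hder : (derivative^[k] (num ℂ τ H)).eval (s : ℂ) = (k ! : ℂ) * (hasseZ τ H k s : ℂ) := by
    have e := congrFun (factorial_smul_hasseDeriv (R := ℂ) (k := k)) (num ℂ τ H)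
    simp only [LinearMap.smul_apply] at e
    rw [← e]
    simp only [nsmul_eq_mul, eval_mul, eval_natCast]
    rw [hasseDeriv_num_eval, cast_hasseZ]
  rw [twist_pow_one, eval_smul, eval_mul, eval_C, nsmul_eq_mul, hder]
  ring

/-! ### Linear independence of the `Δ_τ` and Lemma 6 -/

/-- `num` is monic of degree `N`. [folklore] -/
theorem monic_num (R : Type*) [CommRing R] (N H : ℕ) : (num R N H).Monic :=
  monic_prod_of_monic _ _ fun _ _ => monic_X_add_C _

/-- `deg num = N` (over a nontrivial ring). [folklore] -/
theorem natDegree_num (R : Type*) [CommRing R] [Nontrivial R] (N H : ℕ) :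
    (num R N H).natDegree = N := by
  rw [num, natDegree_prod_of_monic _ _ fun _ _ => monic_X_add_C _]
  simp only [natDegree_X_add_C, Finset.sum_const, card_range, smul_eq_mul, mul_one]

/-- `deg Δ_τ ≤ τ`. [folklore] -/
theorem natDegree_delta_le (τ H : ℕ) : (delta τ H).natDegree ≤ τ := by
  rw [delta]
  refine (natDegree_C_mul_le _ _).trans ?_
  exact natDegree_num_le τ H

/-- The coefficient of `X^τ` in `Δ_τ` is `den_τ⁻¹ ≠ 0`. [folklore] -/
theorem coeff_delta_self (τ H : ℕ) : (delta τ H).coeff τ = ((den τ H : ℂ))⁻¹ := by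
  rw [delta, coeff_C_mul]
  have h := (monic_num ℂ τ H).coeff_natDegree
  rw [natDegree_num] at h
  rw [h, mul_one]

/-- `Δ_b` has no `X^a` for `b < a`. [folklore] -/
theorem coeff_delta_eq_zero {b a : ℕ} (H : ℕ) (h : b < a) : (delta b H).coeff a = 0 :=
  coeff_eq_zero_of_natDegree_lt (lt_of_le_of_lt (natDegree_delta_le b H) h)

/-- **The `Δ_τ` (`τ ≤ T`) are linearly independent**: they have exact degree `τ`. [folklore] -/
theorem eq_zero_of_sum_smul_delta_eq_zero (H T : ℕ) (c : Fin (T + 1) → ℂ)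
    (h : ∑ a : Fin (T + 1), c a • delta (a : ℕ) H = 0) : c = 0 := by
  classical
  by_contra hc
  have hne : (Finset.univ.filter fun a : Fin (T + 1) => c a ≠ 0).Nonempty := by
    by_contra hall
    rw [Finset.not_nonempty_iff_eq_empty, Finset.filter_eq_empty_iff] at hall
    apply hc
    funext a
    simpa using hall (Finset.mem_univ a)
  set a₀ := (Finset.univ.filter fun a : Fin (T + 1) => c a ≠ 0).max' hne with ha₀
  have ha₀mem : c a₀ ≠ 0 := by
    have := Finset.max'_mem _ hne
    rw [← ha₀] at this
    simpa using this
  have hmax : ∀ a : Fin (T + 1), a₀ < a → c a = 0 := by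
    intro a ha
    by_contra hca
    have : a ≤ a₀ := by
      rw [ha₀]
      exact Finset.le_max' _ _ (by simpa using hca)
    exact absurd ha (not_lt.mpr this)
  -- the coefficient of `X^{a₀}` in the relation
  have hcoeff := congrArg (fun P : ℂ[X] => P.coeff (a₀ : ℕ)) h
  simp only [finsetSum_coeff, coeff_smul, coeff_zero, smul_eq_mul] at hcoeff
  rw [Finset.sum_eq_single a₀] at hcoeff
  · rw [coeff_delta_self] at hcoeff
    exact ha₀mem ((mul_eq_zero.mp hcoeff).resolve_right
      (inv_ne_zero (by exact_mod_cast den_ne_zero _ _)))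
  · intro a _ hne'
    rcases lt_or_gt_of_ne hne' with hlt | hgt
    · rw [coeff_delta_eq_zero H (by exact_mod_cast hlt), mul_zero]
    · rw [hmax a hgt, zero_mul]
  · intro h'; exact absurd (Finset.mem_univ _) h'

/-- **Lemma 6 for `π`** ([NesterenkoWaldschmidt1996, §6 a)]) with the basis `Δ_τ(X) Y^t`: if
`α ≠ 0`, `β ≠ 0`, `2T₁ ≤ S + 1` and `(2T₁+1)T < (S+1-2T₁)(2S₁+1)` (condition (2.1)), the matrix
`a(σ,s;τ,t) = ((∂ + tβ)^σ Δ_τ)(s) · α^{ts}` (rows `0 ≤ σ ≤ S`, `|s| ≤ S₁`; columns `0 ≤ τ ≤ T`,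
`|t| ≤ T₁`) has linearly independent columns: a relation gives `R = ∑ c_{τ,t} Δ_τ(X) Y^t ≠ 0`
(the `Δ_τ` are linearly independent) of `X`-degree `≤ T` with `δ^σ R(s, α^s) = 0`, contradicting
`NW1996.multiplicity_estimate`. [cite: NesterenkoWaldschmidt1996, §6 Lemma 6] -/
theorem algMatrix_mulVec_eq_zero_pi {α β : ℂ} (hα : α ≠ 0) (hβ : β ≠ 0) (H : ℕ) {T T₁ S S₁ : ℕ}
    (h2T₁ : 2 * T₁ ≤ S + 1) (hcount : (2 * T₁ + 1) * T < (S + 1 - 2 * T₁) * (2 * S₁ + 1))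
    (c : Fin (T + 1) × Fin (2 * T₁ + 1) → ℂ)
    (hc : (Matrix.of fun (ω : Fin (S + 1) × Fin (2 * S₁ + 1)) (μ : Fin (T + 1) × Fin (2 * T₁ + 1)) =>
        ((twist (((((μ.2 : ℕ) : ℤ) - T₁ : ℤ) : ℂ) * β) ^ (ω.1 : ℕ)) (delta μ.1 H)).eval
            (((((ω.2 : ℕ) : ℤ) - S₁ : ℤ) : ℂ)) *
          α ^ ((((μ.2 : ℕ) : ℤ) - T₁) * ((((ω.2 : ℕ) : ℤ)) - S₁))) *ᵥ c = 0) :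
    c = 0 := by
  classical
  by_contra hc0
  set Q : Fin (2 * T₁ + 1) → ℂ[X] := fun b => ∑ a : Fin (T + 1), c (a, b) • delta (a : ℕ) H with hQ
  set w : Fin (2 * T₁ + 1) → ℂ := fun b => ((((b : ℕ) : ℤ) - T₁ : ℤ) : ℂ) * β with hw
  set pt : Fin (2 * S₁ + 1) → ℂ := fun d => ((((d : ℕ) : ℤ) - S₁ : ℤ) : ℂ) with hpt
  set y : Fin (2 * S₁ + 1) → Fin (2 * T₁ + 1) → ℂ :=
    fun d b => α ^ ((((b : ℕ) : ℤ) - T₁) * (((d : ℕ) : ℤ) - S₁)) with hy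
  have hw_inj : Function.Injective w := by
    intro b b' h
    have h0 : ((((b : ℕ) : ℤ) - T₁ : ℤ) : ℂ) * β = ((((b' : ℕ) : ℤ) - T₁ : ℤ) : ℂ) * β := h
    have h1 := mul_right_cancel₀ hβ h0
    have h' : ((b : ℕ) : ℤ) - T₁ = ((b' : ℕ) : ℤ) - T₁ := by exact_mod_cast h1
    exact Fin.ext (by exact_mod_cast sub_left_inj.mp h')
  have hpt_inj : Function.Injective pt := by
    intro d d' h
    have h0 : ((((d : ℕ) : ℤ) - S₁ : ℤ) : ℂ) = ((((d' : ℕ) : ℤ) - S₁ : ℤ) : ℂ) := h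
    have h' : ((d : ℕ) : ℤ) - S₁ = ((d' : ℕ) : ℤ) - S₁ := by exact_mod_cast h0
    exact Fin.ext (by exact_mod_cast sub_left_inj.mp h')
  have hQne : ∃ b, Q b ≠ 0 := by
    by_contra hall
    push Not at hall
    apply hc0
    funext ab
    obtain ⟨a, b⟩ := ab
    have h := eq_zero_of_sum_smul_delta_eq_zero H T (fun a => c (a, b)) (hall b)
    exact congrFun h a
  have hdeg : ∀ b, (Q b).natDegree ≤ T := by
    intro b
    refine natDegree_sum_le_of_forall_le _ _ fun a _ => (natDegree_smul_le _ _).trans ?_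
    exact (natDegree_delta_le _ _).trans (Nat.lt_succ_iff.mp a.isLt)
  have hy_ne : ∀ d b, y d b ≠ 0 := fun d b => zpow_ne_zero _ hα
  have hvanish : ∀ d, ∀ σ < S + 1,
      ∑ b, ((twist (w b) ^ σ) (Q b)).eval (pt d) * y d b = 0 := by
    intro d σ hσ
    have key : ∀ b, ((twist (w b) ^ σ) (Q b)).eval (pt d) =
        ∑ a : Fin (T + 1), c (a, b) * ((twist (w b) ^ σ) (delta (a : ℕ) H)).eval (pt d) := by
      intro b
      simp only [hQ, map_sum, map_smul, eval_finsetSum, eval_smul, smul_eq_mul]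
    have h := congrFun hc (⟨σ, hσ⟩, d)
    simp only [Matrix.mulVec, dotProduct, Matrix.of_apply, Pi.zero_apply, Fintype.sum_prod_type] at h
    rw [Finset.sum_comm] at h
    rw [← h]
    refine Finset.sum_congr rfl fun b _ => ?_
    rw [key, Finset.sum_mul]
    refine Finset.sum_congr rfl fun a _ => ?_
    simp only [hy, hw, hpt]
    ring
  have hmult := multiplicity_estimate w hw_inj Q hQne hdeg pt hpt_inj y hy_ne hvanish
  simp only [Fintype.card_fin] at hmult
  have h1 : (2 * T₁ + 1 - 1) * (2 * S₁ + 1) = 2 * T₁ * (2 * S₁ + 1) := by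
    rw [Nat.add_sub_cancel]
  rw [h1] at hmult
  have := Nat.add_lt_add_right hcount (2 * T₁ * (2 * S₁ + 1))
  have hsplit : (S + 1) * (2 * S₁ + 1) = (S + 1 - 2 * T₁) * (2 * S₁ + 1) + 2 * T₁ * (2 * S₁ + 1) := by
    rw [← Nat.add_mul, Nat.sub_add_cancel h2T₁]
  omega

/-! ### The scaled integer coefficients `p(σ,τ,s,t,k) = ν(H)^σ C(σ,k) Δ_τ^{(k)}(s) t^{σ-k}` -/

/-- `p(σ,τ,s,t,k) = (ν(H)^σ A(τ,k,s) / den_τ) · C(σ,k) k! t^{σ-k}` for `k ≤ σ` (an integer by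
Lemma 4), and `0` for `k > σ`. [cite: NesterenkoWaldschmidt1996, §6 (6.6)] -/
def pZ (H σ τ : ℕ) (s t : ℤ) (k : ℕ) : ℤ :=
  if k ≤ σ then ((Nat.lcmUpto H : ℤ) ^ σ * hasseZ τ H k s) / (den τ H : ℤ) *
    ((σ.choose k : ℤ) * (k ! : ℤ) * t ^ (σ - k)) else 0

/-- `p(σ,τ,s,t,k) = 0` for `k > σ`. [folklore] -/
theorem pZ_of_lt {H σ τ : ℕ} {s t : ℤ} {k : ℕ} (hk : σ < k) : pZ H σ τ s t k = 0 := by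
  simp [pZ, not_le.mpr hk]

/-- Lemma 4: `den_τ ∣ ν(H)^σ A(τ,k,s)` for `k ≤ σ`. [cite: NesterenkoWaldschmidt1996, §4 Lemma 4] -/
theorem den_dvd_lcm_pow_mul_hasseZ {H σ k : ℕ} (τ : ℕ) (hH : 1 ≤ H) (hk : k ≤ σ) (s : ℤ) :
    (den τ H : ℤ) ∣ (Nat.lcmUpto H : ℤ) ^ σ * hasseZ τ H k s := by
  have h := den_dvd_lcmUpto_pow_mul_coeff_taylor τ H hH hk s
  rw [hasseZ]
  exact_mod_cast h

/-- The value of `p(σ,τ,s,t,k)` in a field of characteristic zero (`k ≤ σ`):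
`ν^σ den_τ⁻¹ C(σ,k) k! A(τ,k,s) t^{σ-k}`. [folklore] -/
theorem cast_pZ {K : Type*} [Field K] [CharZero K] {H σ k : ℕ} (τ : ℕ) (hH : 1 ≤ H) (hk : k ≤ σ)
    (s t : ℤ) :
    (pZ H σ τ s t k : K) = (Nat.lcmUpto H : K) ^ σ * ((den τ H : K))⁻¹ *
      ((σ.choose k : K) * (k ! : K) * (hasseZ τ H k s : K) * (t : K) ^ (σ - k)) := by
  rw [pZ, if_pos hk]
  obtain ⟨q, hq⟩ := den_dvd_lcm_pow_mul_hasseZ τ hH hk s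
  have hden0 : (den τ H : ℤ) ≠ 0 := by exact_mod_cast den_ne_zero τ H
  have hdenK : (den τ H : K) ≠ 0 := by exact_mod_cast den_ne_zero τ H
  rw [hq, Int.mul_ediv_cancel_left _ hden0]
  have hqK : (q : K) = (Nat.lcmUpto H : K) ^ σ * (hasseZ τ H k s : K) * ((den τ H : K))⁻¹ := by
    have h1 : ((den τ H : ℤ) : K) * (q : K) = (((Nat.lcmUpto H : ℤ) ^ σ * hasseZ τ H k s : ℤ) : K) := by
      rw [hq]; push_cast; ring
    push_cast at h1
    field_simp
    linear_combination h1
  push_cast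
  rw [hqK]
  ring

/-- `σ^σ ≤ S^S` for `σ ≤ S` (with `0^0 = 1`). [folklore] -/
theorem pow_self_le_pow_self {σ S : ℕ} (h : σ ≤ S) : (σ : ℝ) ^ σ ≤ (S : ℝ) ^ S := by
  rcases Nat.eq_zero_or_pos σ with rfl | hσ
  · rcases Nat.eq_zero_or_pos S with rfl | hS
    · simp
    · simpa using one_le_pow₀ (M₀ := ℝ) (by exact_mod_cast hS : (1 : ℝ) ≤ S) (n := S)
  · calc (σ : ℝ) ^ σ ≤ (S : ℝ) ^ σ := pow_le_pow_left₀ (Nat.cast_nonneg _) (by exact_mod_cast h) σ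
      _ ≤ (S : ℝ) ^ S := pow_le_pow_right₀ (by exact_mod_cast (hσ.trans_le h : 1 ≤ S)) h

/-- **The row sums of `|p|`** ([NesterenkoWaldschmidt1996, (6.6)] without the prime number bound):
for `σ ≤ S`, `τ ≤ T`, `|s| ≤ S₁`, `|t| ≤ T₁`, `T₁ ≥ 1`, `H ≥ 1`,
`∑_{k ≤ S} |p(σ,τ,s,t,k)| ≤ ν(H)^S T₁^S S^S e^{T+H} (1 + S₁/H)^T`.
[cite: NesterenkoWaldschmidt1996, §6 (6.6)] -/
theorem sum_abs_pZ_le {H σ τ S T S₁ T₁ : ℕ} {s t : ℤ} (hH : 1 ≤ H) (hσ : σ ≤ S) (hτ : τ ≤ T)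
    (hT₁ : 1 ≤ T₁) (hs : |s| ≤ S₁) (ht : |t| ≤ T₁) :
    ∑ k ∈ range (S + 1), |(pZ H σ τ s t k : ℝ)| ≤
      (Nat.lcmUpto H : ℝ) ^ S * (T₁ : ℝ) ^ S * (S : ℝ) ^ S * Real.exp ((T : ℝ) + H) *
        (1 + (S₁ : ℝ) / H) ^ T := by
  have hν1 : (1 : ℝ) ≤ Nat.lcmUpto H := by exact_mod_cast Nat.lcmUpto_pos H
  have hT₁r : (1 : ℝ) ≤ T₁ := by exact_mod_cast hT₁
  have htr : |(t : ℝ)| ≤ T₁ := by rw [← Int.cast_abs]; exact_mod_cast ht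
  have hsr : |(s : ℝ)| ≤ S₁ := by rw [← Int.cast_abs]; exact_mod_cast hs
  have hH0 : (0 : ℝ) < H := by exact_mod_cast hH
  have hden0 : (0 : ℝ) < den τ H := by exact_mod_cast den_pos τ H
  -- restrict the range to `k ≤ σ`
  have hrestr : ∑ k ∈ range (S + 1), |(pZ H σ τ s t k : ℝ)| = ∑ k ∈ range (σ + 1), |(pZ H σ τ s t k : ℝ)| := by
    symm
    refine Finset.sum_subset (Finset.range_subset_range.mpr (by omega)) fun k _ hkσ => ?_
    have hk : σ < k := by simp only [Finset.mem_range, not_lt] at hkσ; omega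
    rw [pZ_of_lt hk, Int.cast_zero, abs_zero]
  rw [hrestr]
  -- termwise
  have hterm : ∀ k ∈ range (σ + 1), |(pZ H σ τ s t k : ℝ)| ≤
      (Nat.lcmUpto H : ℝ) ^ σ * ((den τ H : ℝ))⁻¹ * (T₁ : ℝ) ^ σ *
        ((σ.choose k : ℝ) * k ! * (hasseDeriv k (num ℝ τ H)).eval (|(s : ℝ)|)) := by
    intro k hk
    have hkσ : k ≤ σ := Nat.lt_succ_iff.mp (mem_range.mp hk)
    rw [cast_pZ τ hH hkσ s t, abs_mul, abs_mul, abs_mul, abs_mul, abs_mul, abs_pow, abs_pow,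
      abs_inv, Nat.abs_cast, Nat.abs_cast, Nat.abs_cast, Nat.abs_cast]
    have h1 : |(hasseZ τ H k s : ℝ)| ≤ (hasseDeriv k (num ℝ τ H)).eval (|(s : ℝ)|) := abs_hasseZ_le τ H k s
    have h2 : |(t : ℝ)| ^ (σ - k) ≤ (T₁ : ℝ) ^ σ :=
      (pow_le_pow_left₀ (abs_nonneg _) htr _).trans (pow_le_pow_right₀ hT₁r (Nat.sub_le _ _))
    have h0 : 0 ≤ (σ.choose k : ℝ) * k ! := by positivity
    have hnn := hasseDeriv_num_eval_nonneg τ H k (abs_nonneg (s : ℝ))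
    calc (Nat.lcmUpto H : ℝ) ^ σ * ((den τ H : ℝ))⁻¹ *
          ((σ.choose k : ℝ) * (k ! : ℝ) * |(hasseZ τ H k s : ℝ)| * |(t : ℝ)| ^ (σ - k))
        ≤ (Nat.lcmUpto H : ℝ) ^ σ * ((den τ H : ℝ))⁻¹ *
          ((σ.choose k : ℝ) * (k ! : ℝ) * (hasseDeriv k (num ℝ τ H)).eval (|(s : ℝ)|) * (T₁ : ℝ) ^ σ) := by
          refine mul_le_mul_of_nonneg_left ?_ (by positivity)
          exact mul_le_mul (mul_le_mul_of_nonneg_left h1 h0) h2 (by positivity) (mul_nonneg h0 hnn)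
      _ = _ := by ring
  refine (Finset.sum_le_sum hterm).trans ?_
  rw [← Finset.mul_sum]
  have h43 := sum_choose_mul_factorial_mul_hasse_le τ σ hH (abs_nonneg (s : ℝ))
  -- `(1 + |s|/H)^τ ≤ (1 + S₁/H)^T`
  have hbase : 1 + |(s : ℝ)| / H ≤ 1 + (S₁ : ℝ) / H := by gcongr
  have hbase1 : (1 : ℝ) ≤ 1 + (S₁ : ℝ) / H := by
    have : (0 : ℝ) ≤ (S₁ : ℝ) / H := by positivity
    linarith
  have hpowτ : (1 + |(s : ℝ)| / H) ^ τ ≤ (1 + (S₁ : ℝ) / H) ^ T :=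
    (pow_le_pow_left₀ (by positivity) hbase τ).trans (pow_le_pow_right₀ hbase1 hτ)
  have hexp : Real.exp ((τ : ℝ) + H) ≤ Real.exp ((T : ℝ) + H) := by
    rw [Real.exp_le_exp]; gcongr
  have hσS := pow_self_le_pow_self hσ
  have hνσ : (Nat.lcmUpto H : ℝ) ^ σ ≤ (Nat.lcmUpto H : ℝ) ^ S := pow_le_pow_right₀ hν1 hσ
  have hT₁σ : (T₁ : ℝ) ^ σ ≤ (T₁ : ℝ) ^ S := pow_le_pow_right₀ hT₁r hσ
  calc (Nat.lcmUpto H : ℝ) ^ σ * ((den τ H : ℝ))⁻¹ * (T₁ : ℝ) ^ σ *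
        ∑ k ∈ range (σ + 1), (σ.choose k : ℝ) * k ! * (hasseDeriv k (num ℝ τ H)).eval (|(s : ℝ)|)
      ≤ (Nat.lcmUpto H : ℝ) ^ σ * ((den τ H : ℝ))⁻¹ * (T₁ : ℝ) ^ σ *
        ((σ : ℝ) ^ σ * Real.exp ((τ : ℝ) + H) * (1 + |(s : ℝ)| / H) ^ τ * den τ H) :=
        mul_le_mul_of_nonneg_left h43 (by positivity)
    _ = (Nat.lcmUpto H : ℝ) ^ σ * (T₁ : ℝ) ^ σ * (σ : ℝ) ^ σ * Real.exp ((τ : ℝ) + H) *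
        (1 + |(s : ℝ)| / H) ^ τ := by
        field_simp
    _ ≤ _ := by gcongr

/-! ### The analytic functions `f_{τ,t}(z) = Δ_τ(z) e^{θ t z}` -/

/-- The iterated derivatives of `z ↦ Δ_τ(z)`: `Δ_τ^{(k)}(z) = den_τ⁻¹ k! (hasseDeriv k num_τ)(z)`. [folklore] -/
theorem iteratedDeriv_delta_eval (τ H k : ℕ) (z : ℂ) :
    iteratedDeriv k (fun w => (delta τ H).eval w) z =
      ((den τ H : ℂ))⁻¹ * ((k ! : ℂ) * (hasseDeriv k (num ℂ τ H)).eval z) := by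
  have h : (fun w => (delta τ H).eval w) = fun w => ((den τ H : ℂ))⁻¹ * (num ℂ τ H).eval w := by
    funext w; simp [delta, eval_mul]
  rw [h, iteratedDeriv_const_mul_field, iteratedDeriv_num_eval]

/-- The function `f_{τ,t}(z) = Δ_τ(z) e^{θtz}` is entire. [folklore] -/
theorem differentiable_f (τ H : ℕ) (c : ℂ) :
    Differentiable ℂ (fun z : ℂ => (delta τ H).eval z * cexp (c * z)) :=
  (Polynomial.differentiable _).mul (differentiable_exp.comp (differentiable_id.const_mul c))

/-- **The derivatives of `Δ_τ(z) e^{cz}`** ([NesterenkoWaldschmidt1996, (6.2)]):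
`(d/dz)^σ (Δ_τ(z) e^{cz}) = ∑ₖ C(σ,k) Δ_τ^{(k)}(z) c^{σ-k} e^{cz}`. [cite: NesterenkoWaldschmidt1996, §6 (6.2)] -/
theorem iteratedDeriv_f (τ H σ : ℕ) (c z : ℂ) :
    iteratedDeriv σ (fun w : ℂ => (delta τ H).eval w * cexp (c * w)) z =
      ∑ k ∈ range (σ + 1), (σ.choose k : ℂ) *
        (((den τ H : ℂ))⁻¹ * ((k ! : ℂ) * (hasseDeriv k (num ℂ τ H)).eval z)) *
        (c ^ (σ - k) * cexp (c * z)) := by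
  have hf : ContDiffAt ℂ (σ : ℕ∞) (fun w : ℂ => (delta τ H).eval w) z :=
    (Polynomial.differentiable _).contDiff.contDiffAt
  have hg : ContDiffAt ℂ (σ : ℕ∞) (fun w : ℂ => cexp (c * w)) z :=
    (Complex.contDiff_exp.comp (contDiff_const.mul contDiff_id)).contDiffAt
  rw [iteratedDeriv_fun_mul hf hg]
  refine Finset.sum_congr rfl fun k _ => ?_
  rw [iteratedDeriv_delta_eval, congrFun (iteratedDeriv_cexp_const_mul (σ - k) c) z]

/-- `e^{πi·n} = (-1)^n` for an integer `n`. [folklore] -/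
theorem cexp_pi_I_int (n : ℤ) : cexp ((Real.pi : ℂ) * I * n) = (-1 : ℂ) ^ n := by
  rw [show (Real.pi : ℂ) * I * n = (n : ℂ) * ((Real.pi : ℂ) * I) by ring, Complex.exp_int_mul,
    Complex.exp_pi_mul_I]

/-- At an integer point `s`, for `θ = πi` and `t ∈ ℤ`: `f_{τ,t}^{(σ)}(s) =
den_τ⁻¹ (∑ₖ C(σ,k) k! A(τ,k,s) (πi t)^{σ-k}) · (-1)^{ts}`. [cite: NesterenkoWaldschmidt1996, §6 (6.2)] -/
theorem iteratedDeriv_f_int (τ H σ : ℕ) (s t : ℤ) :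
    iteratedDeriv σ (fun w : ℂ => (delta τ H).eval w * cexp ((Real.pi : ℂ) * I * t * w)) (s : ℂ) =
      ((den τ H : ℂ))⁻¹ * (∑ k ∈ range (σ + 1),
        (σ.choose k : ℂ) * (k ! : ℂ) * (hasseZ τ H k s : ℂ) * (((Real.pi : ℂ) * I) * t) ^ (σ - k)) *
        (-1 : ℂ) ^ (t * s) := by
  rw [show (fun w : ℂ => (delta τ H).eval w * cexp ((Real.pi : ℂ) * I * t * w)) =
      fun w : ℂ => (delta τ H).eval w * cexp (((Real.pi : ℂ) * I * t) * w) from rfl, iteratedDeriv_f]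
  have hexp : cexp ((Real.pi : ℂ) * I * t * (s : ℂ)) = (-1 : ℂ) ^ (t * s) := by
    rw [← cexp_pi_I_int (t * s)]; push_cast; ring_nf
  rw [Finset.mul_sum, Finset.sum_mul]
  refine Finset.sum_congr rfl fun k _ => ?_
  rw [hexp, hasseDeriv_num_eval, ← cast_hasseZ]
  ring

/-- `|a^n − b^n| ≤ n R^n |a − b|` for `|a|, |b| ≤ R`, `R ≥ 1`. [folklore] -/
theorem norm_pow_sub_pow_le_of_le {a b : ℂ} {R : ℝ} (hR : 1 ≤ R) (ha : ‖a‖ ≤ R) (hb : ‖b‖ ≤ R) (n : ℕ) :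
    ‖a ^ n - b ^ n‖ ≤ n * R ^ n * ‖a - b‖ := by
  induction n with
  | zero => simp
  | succ n ih =>
    have h : a ^ (n + 1) - b ^ (n + 1) = a * (a ^ n - b ^ n) + (a - b) * b ^ n := by ring
    rw [h]
    refine (norm_add_le _ _).trans ?_
    rw [norm_mul, norm_mul, norm_pow]
    have h1 : ‖a‖ * ‖a ^ n - b ^ n‖ ≤ R * (n * R ^ n * ‖a - b‖) :=
      mul_le_mul ha ih (norm_nonneg _) (by linarith)
    have h2 : ‖a - b‖ * ‖b‖ ^ n ≤ ‖a - b‖ * R ^ n :=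
      mul_le_mul_of_nonneg_left (pow_le_pow_left₀ (norm_nonneg _) hb n) (norm_nonneg _)
    have h3 : R ^ n ≤ R ^ (n + 1) := pow_le_pow_right₀ hR (Nat.le_succ n)
    have h0 : 0 ≤ ‖a - b‖ := norm_nonneg _
    push_cast
    calc ‖a‖ * ‖a ^ n - b ^ n‖ + ‖a - b‖ * ‖b‖ ^ n
        ≤ R * (n * R ^ n * ‖a - b‖) + ‖a - b‖ * R ^ n := add_le_add h1 h2
      _ ≤ R * (n * R ^ n * ‖a - b‖) + ‖a - b‖ * R ^ (n + 1) := by gcongr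
      _ = (n + 1) * R ^ (n + 1) * ‖a - b‖ := by ring

/-- **The bound on the discs** ([NesterenkoWaldschmidt1996, §6 b), (6.5)]): for `σ ≤ S`, `τ ≤ T`,
`H ≥ 1`, `‖c‖ ≤ K`, `1 ≤ K`, `0 ≤ R` and `|z| ≤ R`:
`|(d/dz)^σ (Δ_τ(z) e^{cz})| ≤ S^S e^{T+H} (1 + R/H)^T K^S e^{KR}`.
[cite: NesterenkoWaldschmidt1996, §6 (6.5)] -/
theorem norm_iteratedDeriv_f_le {τ H σ S T : ℕ} (hH : 1 ≤ H) (hσ : σ ≤ S) (hτ : τ ≤ T) {c : ℂ}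
    {K R : ℝ} (hK : 1 ≤ K) (hcK : ‖c‖ ≤ K) (hR : 0 ≤ R) {z : ℂ} (hz : ‖z‖ ≤ R) :
    ‖iteratedDeriv σ (fun w : ℂ => (delta τ H).eval w * cexp (c * w)) z‖ ≤
      (S : ℝ) ^ S * Real.exp ((T : ℝ) + H) * (1 + R / H) ^ T * K ^ S * Real.exp (K * R) := by
  have hH0 : (0 : ℝ) < H := by exact_mod_cast hH
  have hden0 : (0 : ℝ) < den τ H := by exact_mod_cast den_pos τ H
  rw [iteratedDeriv_f]
  refine (norm_sum_le _ _).trans ?_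
  have hexp : ‖cexp (c * z)‖ ≤ Real.exp (K * R) := by
    refine (Complex.norm_exp_le_exp_norm _).trans ?_
    rw [Real.exp_le_exp, norm_mul]
    exact mul_le_mul hcK hz (norm_nonneg _) (by linarith)
  have hterm : ∀ k ∈ range (σ + 1),
      ‖(σ.choose k : ℂ) * (((den τ H : ℂ))⁻¹ * ((k ! : ℂ) * (hasseDeriv k (num ℂ τ H)).eval z)) *
          (c ^ (σ - k) * cexp (c * z))‖ ≤
        ((den τ H : ℝ))⁻¹ * (K ^ σ * Real.exp (K * R)) *
          ((σ.choose k : ℝ) * k ! * ‖(hasseDeriv k (num ℂ τ H)).eval z‖) := by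
    intro k _
    rw [norm_mul, norm_mul, norm_mul, norm_mul, norm_mul, norm_inv, norm_pow, Complex.norm_natCast,
      Complex.norm_natCast, Complex.norm_natCast]
    have h1 : ‖c‖ ^ (σ - k) ≤ K ^ σ :=
      (pow_le_pow_left₀ (norm_nonneg _) hcK _).trans (pow_le_pow_right₀ hK (Nat.sub_le _ _))
    calc (σ.choose k : ℝ) * (((den τ H : ℝ))⁻¹ * ((k ! : ℝ) * ‖(hasseDeriv k (num ℂ τ H)).eval z‖)) *
          (‖c‖ ^ (σ - k) * ‖cexp (c * z)‖)
        ≤ (σ.choose k : ℝ) * (((den τ H : ℝ))⁻¹ * ((k ! : ℝ) * ‖(hasseDeriv k (num ℂ τ H)).eval z‖)) *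
          (K ^ σ * Real.exp (K * R)) := by
          refine mul_le_mul_of_nonneg_left ?_ (by positivity)
          exact mul_le_mul h1 hexp (norm_nonneg _) (by positivity)
      _ = _ := by ring
  refine (Finset.sum_le_sum hterm).trans ?_
  rw [← Finset.mul_sum]
  have h43 := sum_choose_mul_factorial_mul_norm_hasse_le τ σ hH z
  have hbase : 1 + ‖z‖ / H ≤ 1 + R / H := by gcongr
  have hbase1 : (1 : ℝ) ≤ 1 + R / H := by
    have : (0 : ℝ) ≤ R / H := by positivity
    linarith
  have hpowτ : (1 + ‖z‖ / H) ^ τ ≤ (1 + R / H) ^ T :=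
    (pow_le_pow_left₀ (by positivity) hbase τ).trans (pow_le_pow_right₀ hbase1 hτ)
  have hexpτ : Real.exp ((τ : ℝ) + H) ≤ Real.exp ((T : ℝ) + H) := by
    rw [Real.exp_le_exp]; gcongr
  have hσS := pow_self_le_pow_self hσ
  have hKσ : K ^ σ ≤ K ^ S := pow_le_pow_right₀ hK hσ
  calc ((den τ H : ℝ))⁻¹ * (K ^ σ * Real.exp (K * R)) *
        ∑ k ∈ range (σ + 1), (σ.choose k : ℝ) * k ! * ‖(hasseDeriv k (num ℂ τ H)).eval z‖
      ≤ ((den τ H : ℝ))⁻¹ * (K ^ σ * Real.exp (K * R)) *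
        ((σ : ℝ) ^ σ * Real.exp ((τ : ℝ) + H) * (1 + ‖z‖ / H) ^ τ * den τ H) :=
        mul_le_mul_of_nonneg_left h43 (by positivity)
    _ = (σ : ℝ) ^ σ * Real.exp ((τ : ℝ) + H) * (1 + ‖z‖ / H) ^ τ * K ^ σ * Real.exp (K * R) := by
        field_simp
    _ ≤ _ := by gcongr

/-- **The perturbation** ([NesterenkoWaldschmidt1996, §6 b)]) for `θ = πi`, `α = -1 = e^θ`:
the algebraic entry `((∂ + tβ)^σ Δ_τ)(s) (-1)^{ts}` differs from `f_{τ,t}^{(σ)}(s)` by at most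
`S^S e^{T+H} (1 + S₁/H)^T T₁^S · S R^S |β − πi|` when `|β|, π ≤ R`, `R ≥ 1`, `σ ≤ S`, `τ ≤ T`,
`|s| ≤ S₁`, `|t| ≤ T₁`, `T₁ ≥ 1`. [cite: NesterenkoWaldschmidt1996, §6 b)] -/
theorem norm_alg_sub_analytic_le {β : ℂ} {H σ τ S T S₁ T₁ : ℕ} {s t : ℤ} {R : ℝ} (hH : 1 ≤ H)
    (hσ : σ ≤ S) (hτ : τ ≤ T) (hT₁ : 1 ≤ T₁) (hs : |s| ≤ S₁) (ht : |t| ≤ T₁) (hR : 1 ≤ R)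
    (hβR : ‖β‖ ≤ R) (hπR : Real.pi ≤ R) :
    ‖((twist ((t : ℂ) * β) ^ σ) (delta τ H)).eval (s : ℂ) * (-1 : ℂ) ^ (t * s) -
        iteratedDeriv σ (fun w : ℂ => (delta τ H).eval w * cexp ((Real.pi : ℂ) * I * t * w)) (s : ℂ)‖ ≤
      (S : ℝ) ^ S * Real.exp ((T : ℝ) + H) * (1 + (S₁ : ℝ) / H) ^ T * (T₁ : ℝ) ^ S *
        ((S : ℝ) * R ^ S * ‖β - (Real.pi : ℂ) * I‖) := by
  have hH0 : (0 : ℝ) < H := by exact_mod_cast hH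
  have hden0 : (0 : ℝ) < den τ H := by exact_mod_cast den_pos τ H
  have hT₁r : (1 : ℝ) ≤ T₁ := by exact_mod_cast hT₁
  have htr : ‖(t : ℂ)‖ ≤ T₁ := by
    rw [Complex.norm_intCast, ← Int.cast_abs]; exact_mod_cast ht
  have hsr : |(s : ℝ)| ≤ S₁ := by rw [← Int.cast_abs]; exact_mod_cast hs
  have hθ : ‖(Real.pi : ℂ) * I‖ ≤ R := by
    rw [norm_mul, Complex.norm_I, mul_one, Complex.norm_real, Real.norm_eq_abs,
      abs_of_pos Real.pi_pos]
    exact hπR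
  set δ : ℝ := ‖β - (Real.pi : ℂ) * I‖ with hδ
  -- the difference, termwise
  rw [eval_twist_pow_delta, iteratedDeriv_f_int]
  have hdiff : ((den τ H : ℂ))⁻¹ * (∑ k ∈ range (σ + 1),
        (σ.choose k : ℂ) * (k ! : ℂ) * (hasseZ τ H k s : ℂ) * ((t : ℂ) * β) ^ (σ - k)) * (-1 : ℂ) ^ (t * s) -
      ((den τ H : ℂ))⁻¹ * (∑ k ∈ range (σ + 1),
        (σ.choose k : ℂ) * (k ! : ℂ) * (hasseZ τ H k s : ℂ) * (((Real.pi : ℂ) * I) * t) ^ (σ - k)) *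
        (-1 : ℂ) ^ (t * s) =
      ((den τ H : ℂ))⁻¹ * (-1 : ℂ) ^ (t * s) * ∑ k ∈ range (σ + 1),
        (σ.choose k : ℂ) * (k ! : ℂ) * (hasseZ τ H k s : ℂ) * (t : ℂ) ^ (σ - k) *
          (β ^ (σ - k) - ((Real.pi : ℂ) * I) ^ (σ - k)) := by
    rw [Finset.mul_sum, Finset.mul_sum, Finset.sum_mul, Finset.sum_mul, ← Finset.sum_sub_distrib,
      Finset.mul_sum]
    refine Finset.sum_congr rfl fun k _ => ?_
    rw [mul_pow, mul_pow]; ring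
  rw [hdiff, norm_mul, norm_mul, norm_inv, Complex.norm_natCast, norm_zpow, norm_neg, norm_one,
    _root_.one_zpow, mul_one]
  refine le_trans (mul_le_mul_of_nonneg_left (norm_sum_le _ _) (by positivity)) ?_
  have hterm : ∀ k ∈ range (σ + 1),
      ‖(σ.choose k : ℂ) * (k ! : ℂ) * (hasseZ τ H k s : ℂ) * (t : ℂ) ^ (σ - k) *
          (β ^ (σ - k) - ((Real.pi : ℂ) * I) ^ (σ - k))‖ ≤
        ((T₁ : ℝ) ^ σ * ((S : ℝ) * R ^ S * δ)) *
          ((σ.choose k : ℝ) * k ! * (hasseDeriv k (num ℝ τ H)).eval (|(s : ℝ)|)) := by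
    intro k hk
    have hkσ : k ≤ σ := Nat.lt_succ_iff.mp (mem_range.mp hk)
    rw [norm_mul, norm_mul, norm_mul, norm_mul, norm_pow, Complex.norm_natCast, Complex.norm_natCast,
      Complex.norm_intCast]
    have h1 : |(hasseZ τ H k s : ℝ)| ≤ (hasseDeriv k (num ℝ τ H)).eval (|(s : ℝ)|) := abs_hasseZ_le τ H k s
    have h2 : ‖(t : ℂ)‖ ^ (σ - k) ≤ (T₁ : ℝ) ^ σ :=
      (pow_le_pow_left₀ (norm_nonneg _) htr _).trans (pow_le_pow_right₀ hT₁r (Nat.sub_le _ _))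
    have h3 : ‖β ^ (σ - k) - ((Real.pi : ℂ) * I) ^ (σ - k)‖ ≤ (S : ℝ) * R ^ S * δ := by
      refine (norm_pow_sub_pow_le_of_le hR hβR hθ (σ - k)).trans ?_
      have hj : ((σ - k : ℕ) : ℝ) ≤ S := by exact_mod_cast (Nat.sub_le σ k).trans hσ
      have hRj : R ^ (σ - k) ≤ R ^ S := pow_le_pow_right₀ hR ((Nat.sub_le σ k).trans hσ)
      have hδ0 : 0 ≤ δ := norm_nonneg _
      exact mul_le_mul (mul_le_mul hj hRj (by positivity) (by positivity)) le_rfl hδ0 (by positivity)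
    have h0 : (0 : ℝ) ≤ (σ.choose k : ℝ) * k ! := by positivity
    have hnn := hasseDeriv_num_eval_nonneg τ H k (abs_nonneg (s : ℝ))
    have hA : (σ.choose k : ℝ) * (k ! : ℝ) * |(hasseZ τ H k s : ℝ)| ≤
        (σ.choose k : ℝ) * (k ! : ℝ) * (hasseDeriv k (num ℝ τ H)).eval (|(s : ℝ)|) :=
      mul_le_mul_of_nonneg_left h1 h0
    have hB : (σ.choose k : ℝ) * (k ! : ℝ) * |(hasseZ τ H k s : ℝ)| * ‖(t : ℂ)‖ ^ (σ - k) ≤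
        (σ.choose k : ℝ) * (k ! : ℝ) * (hasseDeriv k (num ℝ τ H)).eval (|(s : ℝ)|) * (T₁ : ℝ) ^ σ :=
      mul_le_mul hA h2 (by positivity) (mul_nonneg h0 hnn)
    calc (σ.choose k : ℝ) * (k ! : ℝ) * |(hasseZ τ H k s : ℝ)| * ‖(t : ℂ)‖ ^ (σ - k) *
          ‖β ^ (σ - k) - ((Real.pi : ℂ) * I) ^ (σ - k)‖
        ≤ (σ.choose k : ℝ) * (k ! : ℝ) * (hasseDeriv k (num ℝ τ H)).eval (|(s : ℝ)|) * (T₁ : ℝ) ^ σ *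
          ((S : ℝ) * R ^ S * δ) :=
          mul_le_mul hB h3 (norm_nonneg _) (mul_nonneg (mul_nonneg h0 hnn) (by positivity))
      _ = _ := by ring
  refine le_trans (mul_le_mul_of_nonneg_left (Finset.sum_le_sum hterm) (by positivity)) ?_
  rw [← Finset.mul_sum]
  have h43 := sum_choose_mul_factorial_mul_hasse_le τ σ hH (abs_nonneg (s : ℝ))
  have hbase : 1 + |(s : ℝ)| / H ≤ 1 + (S₁ : ℝ) / H := by gcongr
  have hbase1 : (1 : ℝ) ≤ 1 + (S₁ : ℝ) / H := by
    have : (0 : ℝ) ≤ (S₁ : ℝ) / H := by positivity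
    linarith
  have hpowτ : (1 + |(s : ℝ)| / H) ^ τ ≤ (1 + (S₁ : ℝ) / H) ^ T :=
    (pow_le_pow_left₀ (by positivity) hbase τ).trans (pow_le_pow_right₀ hbase1 hτ)
  have hexpτ : Real.exp ((τ : ℝ) + H) ≤ Real.exp ((T : ℝ) + H) := by
    rw [Real.exp_le_exp]; gcongr
  have hσS := pow_self_le_pow_self hσ
  have hT₁σ : (T₁ : ℝ) ^ σ ≤ (T₁ : ℝ) ^ S := pow_le_pow_right₀ hT₁r hσ
  have hδ0 : 0 ≤ δ := norm_nonneg _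
  calc ((den τ H : ℝ))⁻¹ * ((T₁ : ℝ) ^ σ * ((S : ℝ) * R ^ S * δ) *
        ∑ k ∈ range (σ + 1), (σ.choose k : ℝ) * k ! * (hasseDeriv k (num ℝ τ H)).eval (|(s : ℝ)|))
      ≤ ((den τ H : ℝ))⁻¹ * ((T₁ : ℝ) ^ σ * ((S : ℝ) * R ^ S * δ) *
        ((σ : ℝ) ^ σ * Real.exp ((τ : ℝ) + H) * (1 + |(s : ℝ)| / H) ^ τ * den τ H)) := by
        refine mul_le_mul_of_nonneg_left (mul_le_mul_of_nonneg_left h43 (by positivity)) (by positivity)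
    _ = (σ : ℝ) ^ σ * Real.exp ((τ : ℝ) + H) * (1 + |(s : ℝ)| / H) ^ τ * (T₁ : ℝ) ^ σ *
        ((S : ℝ) * R ^ S * δ) := by
        field_simp
    _ ≤ _ := by gcongr

/-! ### The scaled entries and `(-1)^{ts}` -/

/-- `(-1)^n = (-1)^{|n|}` for an integer exponent. [folklore] -/
theorem neg_one_zpow_eq_pow_natAbs (n : ℤ) : (-1 : ℂ) ^ n = (-1 : ℂ) ^ n.natAbs := by
  rcases Int.natAbs_eq n with h | h
  · conv_lhs => rw [h]
    exact zpow_natCast _ _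
  · conv_lhs => rw [h]
    rw [_root_.zpow_neg, zpow_natCast]
    refine inv_eq_of_mul_eq_one_right ?_
    rw [← pow_add, ← two_mul, pow_mul]
    norm_num

/-- **The scaled algebraic entry is an integer polynomial in `β`**: for `σ ≤ S`, `H ≥ 1`,
`ν(H)^σ · ((∂ + tβ)^σ Δ_τ)(s) (-1)^{ts} = (∑_{k ≤ S} p(σ,τ,s,t,k) β^{σ-k}) (-1)^{|ts|}`.
[cite: NesterenkoWaldschmidt1996, §6 c)] -/
theorem scaled_entry_eq {β : ℂ} {H σ S : ℕ} (τ : ℕ) (hH : 1 ≤ H) (hσ : σ ≤ S) (s t : ℤ) :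
    (Nat.lcmUpto H : ℂ) ^ σ * (((twist ((t : ℂ) * β) ^ σ) (delta τ H)).eval (s : ℂ) * (-1 : ℂ) ^ (t * s)) =
      (∑ k ∈ range (S + 1), (pZ H σ τ s t k : ℂ) * β ^ (σ - k)) * (-1 : ℂ) ^ (t * s).natAbs := by
  rw [eval_twist_pow_delta, neg_one_zpow_eq_pow_natAbs]
  have hrestr : ∑ k ∈ range (S + 1), (pZ H σ τ s t k : ℂ) * β ^ (σ - k) =
      ∑ k ∈ range (σ + 1), (pZ H σ τ s t k : ℂ) * β ^ (σ - k) := by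
    symm
    refine Finset.sum_subset (Finset.range_subset_range.mpr (by omega)) fun k _ hkσ => ?_
    have hk : σ < k := by simp only [Finset.mem_range, not_lt] at hkσ; omega
    rw [pZ_of_lt hk, Int.cast_zero, zero_mul]
  rw [hrestr, ← mul_assoc, Finset.mul_sum, Finset.mul_sum]
  congr 1
  refine Finset.sum_congr rfl fun k hk => ?_
  have hkσ : k ≤ σ := Nat.lt_succ_iff.mp (mem_range.mp hk)
  rw [cast_pZ τ hH hkσ s t, mul_pow]
  ring

end NWPi

/-! ## The core contradiction for `θ = πi`, `α = -1`, abstract parameters -/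

namespace NWPi

open FeldmanDelta NW1996 Waldschmidt1978 Complex Matrix

-- one long proof (steps a)–d) share the matrix data)
set_option maxHeartbeats 1600000 in
/-- **The core of the approximation measure for `π`** ([NesterenkoWaldschmidt1996, §6 a)–d)] for
`θ = πi`, `α = e^θ = -1`, `β` algebraic (`≈ πi`), with the basis `Δ(z; τ, H) e^{θtz}` of §4 and
ABSTRACT parameters `H, T, T₁, S, S₁`, radius ratio `E ≥ 1`, a bound `R ≥ max(|β|, π)`, a bound
`lν ≥ log ν(H)`, the minimal polynomial `Q_β` of `β` over `ℤ` (`D = deg Q_β ≤ Dr`,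
`log M(Q_β) ≤ H_β`), the smallness `S R^S |β − πi| E^L ≤ 1` (`L = (T+1)(2T₁+1)`) and the MAIN
INEQUALITY `hmain` (the analogue of "`84.83 DUVW log E < ½ L log E`", p. 6): contradiction.
Steps: a) Lemma 6 (`algMatrix_mulVec_eq_zero_pi`) gives a non-singular `L × L` minor `𝒟` of
`a(σ,s;τ,t) = ((∂ + tβ)^σ Δ_τ)(s) (-1)^{ts}`; b) `𝒟 = det(f_{τ,t}^{(σ)}(s) + p)` with
`f_{τ,t} = Δ_τ(z) e^{πitz}`, `|p| ≤ E^{-L} 𝔐`, so Lemma 3 (`NW1996.norm_det_interpolation_deriv_le`)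
bounds `|𝒟|` from above; c) `∏ ν(H)^{σ_μ} · 𝒟 = G(β)`, `G ∈ ℤ[X]` of degree `≤ LS` and length
`≤ L! 𝔓^L` (Lemma 4 integrality, `Waldschmidt1978.det_expand`), so Liouville's inequality
(`NW1996.liouville`, Lemma 5 with `n = 1`) bounds `|𝒟|` from below; d) the bounds contradict
`hmain`. [cite: NesterenkoWaldschmidt1996, §6 a)–d)] -/
theorem pi_core {β : ℂ} (hβ0 : β ≠ 0) {Qβ : ℤ[X]} (hQβ : Irreducible (Qβ.map (Int.castRingHom ℚ)))
    (hβQ : aeval β Qβ = 0) {Dr Hβ : ℝ} (hDr : (Qβ.natDegree : ℝ) ≤ Dr)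
    (hHβ : Real.log (Qβ.map (Int.castRingHom ℂ)).mahlerMeasure ≤ Hβ)
    {H T T₁ S S₁ : ℕ} (hH : 1 ≤ H) (hT₁ : 1 ≤ T₁) (hS₁ : 1 ≤ S₁)
    (h2T₁ : 2 * T₁ ≤ S + 1) (hcount : (2 * T₁ + 1) * T < (S + 1 - 2 * T₁) * (2 * S₁ + 1))
    {L : ℕ} (hL : L = (T + 1) * (2 * T₁ + 1))
    {E R lν : ℝ} (hE : 1 ≤ E) (hR : 1 ≤ R) (hβR : ‖β‖ ≤ R) (hπR : Real.pi ≤ R)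
    (hlν : Real.log (Nat.lcmUpto H) ≤ lν)
    (hδ : (S : ℝ) * R ^ S * ‖β - (Real.pi : ℂ) * I‖ * E ^ L ≤ 1)
    (hmain : (L : ℝ) * Real.log 2 + Dr * L * Real.log L +
        (Dr - 1) * L * (S * lν + S * Real.log T₁ + S * Real.log S + ((T : ℝ) + H) +
          T * Real.log (1 + (S₁ : ℝ) / H)) +
        L * S * Hβ + L * S * lν +
        L * (S * Real.log S + ((T : ℝ) + H) + T * Real.log (1 + E * S₁ / H) +
          S * Real.log (Real.pi * T₁) + Real.pi * T₁ * (E * S₁)) +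
        L * S * Real.log E <
      (L : ℝ) * ((L : ℝ) - 1) / 2 * Real.log E) :
    False := by
  classical
  /- names and basic facts -/
  set θ : ℂ := (Real.pi : ℂ) * I with hθ
  set δ : ℝ := ‖β - θ‖ with hδdef
  set ν : ℕ := Nat.lcmUpto H with hν
  set D : ℕ := Qβ.natDegree with hD
  set Mβ : ℝ := (Qβ.map (Int.castRingHom ℂ)).mahlerMeasure with hMβ
  have hE0 : 0 < E := by linarith
  have hR0 : 0 ≤ R := by linarith
  have hT₁r : (1 : ℝ) ≤ T₁ := by exact_mod_cast hT₁
  have hS₁r : (1 : ℝ) ≤ S₁ := by exact_mod_cast hS₁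
  have hH0 : (0 : ℝ) < H := by exact_mod_cast hH
  have hν0 : 0 < ν := Nat.lcmUpto_pos H
  have hνr : (1 : ℝ) ≤ ν := by exact_mod_cast hν0
  have hπ1 : (1 : ℝ) ≤ Real.pi := by have := Real.pi_gt_three; linarith
  have hK1 : (1 : ℝ) ≤ Real.pi * T₁ := one_le_mul_of_one_le_of_one_le hπ1 hT₁r
  have hQ0 : Qβ ≠ 0 := by intro h; apply hQβ.ne_zero; rw [h, Polynomial.map_zero]
  have hM1 : 1 ≤ Mβ := one_le_mahlerMeasure_map hQ0
  have hcard : Fintype.card (Fin (T + 1) × Fin (2 * T₁ + 1)) = L := by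
    simp [Fintype.card_prod, Fintype.card_fin, hL]
  have hL1 : 1 ≤ L := by rw [hL]; exact Nat.one_le_iff_ne_zero.mpr (by positivity)
  have hLpos : (0 : ℝ) < L := by exact_mod_cast hL1
  set ε : ℝ := (E ^ L)⁻¹ with hε
  have hεpos : 0 < ε := by rw [hε]; positivity
  /- a) the matrix and a non-singular minor -/
  set A : Matrix (Fin (S + 1) × Fin (2 * S₁ + 1)) (Fin (T + 1) × Fin (2 * T₁ + 1)) ℂ :=
    Matrix.of fun ω μ =>
      ((twist (((((μ.2 : ℕ) : ℤ) - T₁ : ℤ) : ℂ) * β) ^ (ω.1 : ℕ)) (delta μ.1 H)).eval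
          (((((ω.2 : ℕ) : ℤ) - S₁ : ℤ) : ℂ)) *
        (-1 : ℂ) ^ ((((μ.2 : ℕ) : ℤ) - T₁) * ((((ω.2 : ℕ) : ℤ)) - S₁)) with hA
  have hcols : ∀ c, A *ᵥ c = 0 → c = 0 :=
    fun c hc => algMatrix_mulVec_eq_zero_pi (by norm_num : (-1 : ℂ) ≠ 0) hβ0 H h2T₁ hcount c hc
  obtain ⟨r, hr⟩ := exists_submatrix_det_ne_zero A hcols
  set σr : Fin (T + 1) × Fin (2 * T₁ + 1) → ℕ := fun i => ((r i).1 : ℕ) with hσr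
  set sr : Fin (T + 1) × Fin (2 * T₁ + 1) → ℤ := fun i => (((r i).2 : ℕ) : ℤ) - S₁ with hsr
  set tc : Fin (T + 1) × Fin (2 * T₁ + 1) → ℤ := fun j => (((j.2 : ℕ) : ℤ) - T₁) with htc
  have hσrS : ∀ i, σr i ≤ S := fun i => Nat.lt_succ_iff.mp (r i).1.isLt
  have hsrS : ∀ i, |sr i| ≤ S₁ := fun i => abs_coord_le S₁ (r i).2
  have htcT : ∀ j, |tc j| ≤ T₁ := fun j => abs_coord_le T₁ j.2
  have hτT : ∀ j : Fin (T + 1) × Fin (2 * T₁ + 1), (j.1 : ℕ) ≤ T := fun j =>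
    Nat.lt_succ_iff.mp j.1.isLt
  set Asq : Matrix (Fin (T + 1) × Fin (2 * T₁ + 1)) (Fin (T + 1) × Fin (2 * T₁ + 1)) ℂ :=
    A.submatrix r id with hAsq
  have hAsq_apply : ∀ i j, Asq i j =
      ((twist ((tc j : ℂ) * β) ^ (σr i)) (delta (j.1 : ℕ) H)).eval (sr i : ℂ) *
        (-1 : ℂ) ^ (tc j * sr i) := by
    intro i j; simp [hAsq, hA, hσr, hsr, htc]
  have hdet : Asq.det ≠ 0 := hr
  /- b) the analytic upper bound -/
  set f : Fin (T + 1) × Fin (2 * T₁ + 1) → ℂ → ℂ :=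
    fun j z => (delta (j.1 : ℕ) H).eval z * cexp ((Real.pi : ℂ) * I * (tc j) * z) with hf
  have hf_diff : ∀ j, Differentiable ℂ (f j) := fun j => differentiable_f _ _ _
  set ζ : Fin (T + 1) × Fin (2 * T₁ + 1) → ℂ := fun i => ((sr i : ℤ) : ℂ) with hζ
  set P : Fin (T + 1) × Fin (2 * T₁ + 1) → Fin (T + 1) × Fin (2 * T₁ + 1) → ℂ :=
    fun i j => Asq i j - iteratedDeriv (σr i) (f j) (ζ i) with hP
  set 𝔐 : ℝ := (S : ℝ) ^ S * Real.exp ((T : ℝ) + H) * (1 + E * S₁ / H) ^ T * (Real.pi * T₁) ^ S *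
    Real.exp (Real.pi * T₁ * (E * S₁)) with h𝔐
  set 𝔓₀ : ℝ := (S : ℝ) ^ S * Real.exp ((T : ℝ) + H) * (1 + (S₁ : ℝ) / H) ^ T * (T₁ : ℝ) ^ S with h𝔓₀
  have hSS : (0 : ℝ) < (S : ℝ) ^ S := by
    rcases Nat.eq_zero_or_pos S with h | h
    · subst h; simp
    · exact pow_pos (by exact_mod_cast h) S
  have h𝔐pos : 0 < 𝔐 := by
    rw [h𝔐]
    exact mul_pos (mul_pos (mul_pos (mul_pos hSS (Real.exp_pos _)) (pow_pos (by positivity) T))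
      (pow_pos (by positivity) S)) (Real.exp_pos _)
  have h𝔓₀pos : 0 < 𝔓₀ := by
    rw [h𝔓₀]
    exact mul_pos (mul_pos (mul_pos hSS (Real.exp_pos _)) (pow_pos (by positivity) T))
      (pow_pos (by positivity) S)
  have hζS₁ : ∀ i, ‖ζ i‖ ≤ S₁ := by
    intro i
    simp only [hζ, Complex.norm_intCast]
    have := hsrS i
    rw [← Int.cast_abs]; exact_mod_cast this
  have hES₁0 : 0 ≤ E * S₁ := by positivity
  have hfM : ∀ i j z, ‖z‖ ≤ E * (S₁ : ℝ) → ‖iteratedDeriv (σr i) (f j) z‖ ≤ 𝔐 := by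
    intro i j z hz
    have hcK : ‖(Real.pi : ℂ) * I * (tc j)‖ ≤ Real.pi * T₁ := by
      rw [norm_mul, norm_mul, Complex.norm_I, mul_one, Complex.norm_real, Real.norm_eq_abs,
        abs_of_pos Real.pi_pos, Complex.norm_intCast]
      refine mul_le_mul_of_nonneg_left ?_ Real.pi_pos.le
      rw [← Int.cast_abs]; exact_mod_cast htcT j
    have h := norm_iteratedDeriv_f_le (τ := (j.1 : ℕ)) hH (hσrS i) (hτT j) hK1 hcK hES₁0 hz
    rw [h𝔐]
    exact h
  -- the perturbation
  have hPM : ∀ i j, ‖P i j‖ ≤ ε * 𝔐 := by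
    intro i j
    have h1 : ‖P i j‖ ≤ 𝔓₀ * ((S : ℝ) * R ^ S * δ) := by
      simp only [hP]
      rw [hAsq_apply]
      exact norm_alg_sub_analytic_le hH (hσrS i) (hτT j) hT₁ (hsrS i) (htcT j) hR hβR hπR
    have h2 : (S : ℝ) * R ^ S * δ ≤ ε := by
      have hEL : (0 : ℝ) < E ^ L := by positivity
      rw [hε]
      calc (S : ℝ) * R ^ S * δ = ((S : ℝ) * R ^ S * δ * E ^ L) * (E ^ L)⁻¹ := by field_simp
        _ ≤ 1 * (E ^ L)⁻¹ := by gcongr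
        _ = (E ^ L)⁻¹ := one_mul _
    have h3 : 𝔓₀ ≤ 𝔐 := by
      rw [h𝔓₀, h𝔐]
      have hb : (1 + (S₁ : ℝ) / H) ^ T ≤ (1 + E * S₁ / H) ^ T := by
        apply pow_le_pow_left₀ (by positivity)
        have : (S₁ : ℝ) / H ≤ E * S₁ / H := by
          rw [div_le_div_iff_of_pos_right hH0]; nlinarith
        linarith
      have hc : (T₁ : ℝ) ^ S ≤ (Real.pi * T₁) ^ S :=
        pow_le_pow_left₀ (by positivity) (by nlinarith) S
      have hd : (1 : ℝ) ≤ Real.exp (Real.pi * T₁ * (E * S₁)) := Real.one_le_exp (by positivity)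
      calc (S : ℝ) ^ S * Real.exp ((T : ℝ) + H) * (1 + (S₁ : ℝ) / H) ^ T * (T₁ : ℝ) ^ S
          = (S : ℝ) ^ S * Real.exp ((T : ℝ) + H) * (1 + (S₁ : ℝ) / H) ^ T * (T₁ : ℝ) ^ S * 1 := by ring
        _ ≤ _ := by gcongr
    calc ‖P i j‖ ≤ 𝔓₀ * ((S : ℝ) * R ^ S * δ) := h1
      _ ≤ 𝔐 * ε := mul_le_mul h3 h2 (by positivity) h𝔐pos.le
      _ = ε * 𝔐 := mul_comm _ _
  have hεE : ε * E ^ Fintype.card (Fin (T + 1) × Fin (2 * T₁ + 1)) ≤ 1 := by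
    rw [hcard, hε, inv_mul_cancel₀ (by positivity)]
  have hAsq_eq : Asq = Matrix.of fun i j => iteratedDeriv (σr i) (f j) (ζ i) + P i j := by
    ext i j; simp [hP]
  have hup := norm_det_interpolation_deriv_le f hf_diff σr ζ P hE hζS₁ h𝔐pos.le hεpos.le hεE hfM hPM
  rw [← hAsq_eq, hcard] at hup
  have hsumσ : ∑ i, σr i ≤ L * S := by
    calc ∑ i, σr i ≤ ∑ _i : Fin (T + 1) × Fin (2 * T₁ + 1), S := Finset.sum_le_sum fun i _ => hσrS i
      _ = L * S := by rw [Finset.sum_const, Finset.card_univ, hcard, smul_eq_mul]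
  have hUB : ‖Asq.det‖ * E ^ (∑ x ∈ range L, x) ≤ 2 ^ L * (L : ℝ) ^ L * 𝔐 ^ L * E ^ (L * S) := by
    have h1 : ‖Asq.det‖ ≤ 2 ^ L * (L.factorial : ℝ) * 𝔐 ^ L * E ^ (∑ i, σr i) / E ^ (∑ x ∈ range L, x) := hup
    rw [le_div_iff₀ (by positivity)] at h1
    refine h1.trans ?_
    have h2 : (L.factorial : ℝ) ≤ (L : ℝ) ^ L := by exact_mod_cast Nat.factorial_le_pow L
    have h3 : E ^ (∑ i, σr i) ≤ E ^ (L * S) := pow_le_pow_right₀ hE hsumσ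
    gcongr
  /- c) the arithmetic lower bound -/
  set pM : Fin (T + 1) × Fin (2 * T₁ + 1) → Fin (T + 1) × Fin (2 * T₁ + 1) → ℕ → ℤ :=
    fun i j k => pZ H (σr i) (j.1 : ℕ) (sr i) (tc j) k with hpM
  set dM : Fin (T + 1) × Fin (2 * T₁ + 1) → ℕ → ℕ := fun i k => σr i - k with hdM
  set eM : Fin (T + 1) × Fin (2 * T₁ + 1) → Fin (T + 1) × Fin (2 * T₁ + 1) → ℕ :=
    fun i j => (tc j * sr i).natAbs with heM
  have hscaled : ∀ i j, (ν : ℂ) ^ (σr i) * Asq i j =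
      (∑ k ∈ range (S + 1), (pM i j k : ℂ) * β ^ dM i k) * (-1 : ℂ) ^ eM i j := by
    intro i j
    rw [hAsq_apply]
    exact scaled_entry_eq (j.1 : ℕ) hH (hσrS i) (sr i) (tc j)
  set N₀ : ℂ := ∏ i, (ν : ℂ) ^ (σr i) with hN₀
  have hN₀ne : N₀ ≠ 0 := by
    rw [hN₀]
    exact Finset.prod_ne_zero_iff.mpr fun i _ => pow_ne_zero _ (by exact_mod_cast hν0.ne')
  have hN₀norm : ‖N₀‖ ≤ (ν : ℝ) ^ (L * S) := by
    rw [hN₀, norm_prod]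
    simp only [norm_pow, Complex.norm_natCast]
    rw [Finset.prod_pow_eq_pow_sum]
    exact pow_le_pow_right₀ hνr hsumσ
  have hdet_scaled : (Matrix.of fun i j =>
      (∑ k ∈ range (S + 1), (pM i j k : ℂ) * β ^ dM i k) * (-1 : ℂ) ^ eM i j).det = N₀ * Asq.det := by
    have : (Matrix.of fun i j => (∑ k ∈ range (S + 1), (pM i j k : ℂ) * β ^ dM i k) * (-1 : ℂ) ^ eM i j) =
        Matrix.of fun i j => (ν : ℂ) ^ (σr i) * Asq i j := by
      ext i j; rw [Matrix.of_apply, Matrix.of_apply, hscaled]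
    rw [this, Matrix.det_mul_column]
  have hexpand := det_expand pM dM eM S β (-1 : ℂ)
  -- the integer polynomial `G` with `G(β) = N₀ 𝒟`
  set ιs : Finset (Equiv.Perm (Fin (T + 1) × Fin (2 * T₁ + 1)) × (Fin (T + 1) × Fin (2 * T₁ + 1) → ℕ)) :=
    (univ : Finset (Equiv.Perm (Fin (T + 1) × Fin (2 * T₁ + 1)))) ×ˢ
      Fintype.piFinset (fun _ : Fin (T + 1) × Fin (2 * T₁ + 1) => range (S + 1)) with hιs
  set aC : Equiv.Perm (Fin (T + 1) × Fin (2 * T₁ + 1)) × (Fin (T + 1) × Fin (2 * T₁ + 1) → ℕ) → ℤ :=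
    fun l => ((Equiv.Perm.sign l.1 : ℤˣ) : ℤ) * ∏ j, pM (l.1 j) j (l.2 j) with haC
  set dC : Equiv.Perm (Fin (T + 1) × Fin (2 * T₁ + 1)) × (Fin (T + 1) × Fin (2 * T₁ + 1) → ℕ) → ℕ :=
    fun l => ∑ j, dM (l.1 j) (l.2 j) with hdC
  set eC : Equiv.Perm (Fin (T + 1) × Fin (2 * T₁ + 1)) × (Fin (T + 1) × Fin (2 * T₁ + 1) → ℕ) → ℕ :=
    fun l => ∑ j, eM (l.1 j) j with heC
  set G : ℤ[X] := ∑ l ∈ ιs, C (aC l * (-1) ^ eC l) * X ^ dC l with hG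
  have haevalG : aeval β G = N₀ * Asq.det := by
    rw [← hdet_scaled, hexpand, hG, map_sum]
    refine Finset.sum_congr rfl fun l _ => ?_
    rw [map_mul, aeval_C, map_pow, aeval_X, algebraMap_int_eq, eq_intCast]
    simp only [haC, hdC, heC]
    push_cast
    ring
  have hGne : aeval β G ≠ 0 := by
    rw [haevalG]; exact mul_ne_zero hN₀ne hdet
  -- degree of `G`
  have hdegG : G.natDegree ≤ L * S := by
    rw [hG]
    refine natDegree_sum_monomial_le _ _ _ fun l _ => ?_
    calc dC l = ∑ j, (σr (l.1 j) - l.2 j) := rfl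
      _ ≤ ∑ j, σr (l.1 j) := Finset.sum_le_sum fun j _ => Nat.sub_le _ _
      _ = ∑ i, σr i := Equiv.sum_comp l.1 σr
      _ ≤ L * S := hsumσ
  -- length of `G`
  set 𝔓 : ℝ := (ν : ℝ) ^ S * (T₁ : ℝ) ^ S * (S : ℝ) ^ S * Real.exp ((T : ℝ) + H) *
    (1 + (S₁ : ℝ) / H) ^ T with h𝔓
  have h𝔓pos : 0 < 𝔓 := by
    rw [h𝔓]
    exact mul_pos (mul_pos (mul_pos (mul_pos (pow_pos (by positivity) S) (pow_pos (by positivity) S))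
      hSS) (Real.exp_pos _)) (pow_pos (by positivity) T)
  have hrow : ∀ i j, ∑ k ∈ range (S + 1), |(pM i j k : ℝ)| ≤ 𝔓 := fun i j =>
    sum_abs_pZ_le hH (hσrS i) (hτT j) hT₁ (hsrS i) (htcT j)
  set Λ : ℝ := (L : ℝ) ^ L * 𝔓 ^ L with hΛ
  have hΛpos : 0 < Λ := by rw [hΛ]; positivity
  have hlenG : ∑ k ∈ range (G.natDegree + 1), |(G.coeff k : ℝ)| ≤ Λ := by
    rw [hG]
    refine (length_sum_monomial_le _ _ _).trans ?_
    have habs : ∀ l ∈ ιs, |((aC l * (-1) ^ eC l : ℤ) : ℝ)| = |(aC l : ℝ)| := by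
      intro l _
      push_cast
      rw [abs_mul, abs_pow, abs_neg, abs_one, one_pow, mul_one]
    rw [Finset.sum_congr rfl habs]
    have h := sum_abs_detCoeff_le pM S hrow
    rw [hcard] at h
    refine h.trans ?_
    rw [hΛ]
    gcongr
    exact_mod_cast Nat.factorial_le_pow L
  -- Liouville
  have hLiou := liouville hQβ hβQ hGne hlenG
  have hLB : 1 ≤ Λ ^ (D - 1) * Mβ ^ (L * S) * (ν : ℝ) ^ (L * S) * ‖Asq.det‖ := by
    have h1 : (1 : ℝ) ≤ max 1 ‖β‖ ^ G.natDegree := one_le_pow₀ (le_max_left _ _)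
    have h2 : Mβ ^ G.natDegree ≤ Mβ ^ (L * S) := pow_le_pow_right₀ hM1 hdegG
    have h3 : ‖aeval β G‖ ≤ (ν : ℝ) ^ (L * S) * ‖Asq.det‖ := by
      rw [haevalG, norm_mul]
      exact mul_le_mul_of_nonneg_right hN₀norm (norm_nonneg _)
    calc (1 : ℝ) ≤ max 1 ‖β‖ ^ G.natDegree := h1
      _ ≤ Λ ^ (D - 1) * Mβ ^ G.natDegree * ‖aeval β G‖ := hLiou
      _ ≤ Λ ^ (D - 1) * Mβ ^ (L * S) * ((ν : ℝ) ^ (L * S) * ‖Asq.det‖) := by gcongr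
      _ = _ := by ring
  /- d) the contradiction -/
  have hcomb : E ^ (∑ x ∈ range L, x) ≤
      Λ ^ (D - 1) * Mβ ^ (L * S) * (ν : ℝ) ^ (L * S) * (2 ^ L * (L : ℝ) ^ L * 𝔐 ^ L * E ^ (L * S)) := by
    have h1 := mul_le_mul_of_nonneg_left hUB
      (by positivity : (0 : ℝ) ≤ Λ ^ (D - 1) * Mβ ^ (L * S) * (ν : ℝ) ^ (L * S))
    have h2 := mul_le_mul_of_nonneg_right hLB (by positivity : (0 : ℝ) ≤ E ^ (∑ x ∈ range L, x))
    rw [one_mul] at h2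
    calc E ^ (∑ x ∈ range L, x)
        ≤ Λ ^ (D - 1) * Mβ ^ (L * S) * (ν : ℝ) ^ (L * S) * ‖Asq.det‖ * E ^ (∑ x ∈ range L, x) := h2
      _ = Λ ^ (D - 1) * Mβ ^ (L * S) * (ν : ℝ) ^ (L * S) * (‖Asq.det‖ * E ^ (∑ x ∈ range L, x)) := by ring
      _ ≤ _ := h1
  -- logarithms
  have hsumL : ((∑ x ∈ range L, x : ℕ) : ℝ) = (L : ℝ) * (L - 1) / 2 := by
    have h := Finset.sum_range_id_mul_two L
    have h' : ((∑ x ∈ range L, x : ℕ) : ℝ) * 2 = (L : ℝ) * ((L - 1 : ℕ) : ℝ) := by exact_mod_cast h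
    rw [Nat.cast_sub hL1, Nat.cast_one] at h'
    linarith only [h']
  have hlogLHS : Real.log (E ^ (∑ x ∈ range L, x)) = (L : ℝ) * ((L : ℝ) - 1) / 2 * Real.log E := by
    rw [Real.log_pow, hsumL]
  have hνS : (0 : ℝ) < (ν : ℝ) ^ S := pow_pos (by positivity) S
  have hT₁S : (0 : ℝ) < (T₁ : ℝ) ^ S := pow_pos (by positivity) S
  have hbT : (0 : ℝ) < (1 + (S₁ : ℝ) / H) ^ T := pow_pos (by positivity) T
  have hbT' : (0 : ℝ) < (1 + E * S₁ / H) ^ T := pow_pos (by positivity) T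
  have hKS : (0 : ℝ) < (Real.pi * T₁) ^ S := pow_pos (by positivity) S
  have hlog𝔓 : Real.log 𝔓 = S * Real.log ν + S * Real.log T₁ + S * Real.log S + ((T : ℝ) + H) +
      T * Real.log (1 + (S₁ : ℝ) / H) := by
    rw [h𝔓, Real.log_mul (by positivity) hbT.ne', Real.log_mul (by positivity) (Real.exp_pos _).ne',
      Real.log_mul (by positivity) hSS.ne', Real.log_mul hνS.ne' hT₁S.ne', Real.log_pow, Real.log_pow,
      Real.log_pow, Real.log_pow, Real.log_exp]
  have hlogΛ : Real.log Λ = L * Real.log L + L * Real.log 𝔓 := by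
    rw [hΛ, Real.log_mul (by positivity) (by positivity), Real.log_pow, Real.log_pow]
  have hlog𝔐 : Real.log 𝔐 = S * Real.log S + ((T : ℝ) + H) + T * Real.log (1 + E * S₁ / H) +
      S * Real.log (Real.pi * T₁) + Real.pi * T₁ * (E * S₁) := by
    rw [h𝔐, Real.log_mul (by positivity) (Real.exp_pos _).ne', Real.log_mul (by positivity) hKS.ne',
      Real.log_mul (by positivity) hbT'.ne', Real.log_mul hSS.ne' (Real.exp_pos _).ne',
      Real.log_pow, Real.log_pow, Real.log_pow, Real.log_exp, Real.log_exp]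
  have hMβLS : (0 : ℝ) < Mβ ^ (L * S) := pow_pos (by linarith) _
  have hνLS : (0 : ℝ) < (ν : ℝ) ^ (L * S) := pow_pos (by positivity) _
  have hΛD : (0 : ℝ) < Λ ^ (D - 1) := pow_pos hΛpos _
  have h𝔐L : (0 : ℝ) < 𝔐 ^ L := pow_pos h𝔐pos _
  have hlogRHS : Real.log (Λ ^ (D - 1) * Mβ ^ (L * S) * (ν : ℝ) ^ (L * S) *
      (2 ^ L * (L : ℝ) ^ L * 𝔐 ^ L * E ^ (L * S))) =
      ((D - 1 : ℕ) : ℝ) * Real.log Λ + (L * S : ℕ) * Real.log Mβ + (L * S : ℕ) * Real.log ν +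
        (L * Real.log 2 + L * Real.log L + L * Real.log 𝔐 + (L * S : ℕ) * Real.log E) := by
    rw [Real.log_mul (by positivity) (by positivity), Real.log_mul (by positivity) hνLS.ne',
      Real.log_mul hΛD.ne' hMβLS.ne', Real.log_mul (by positivity) (by positivity),
      Real.log_mul (by positivity) h𝔐L.ne', Real.log_mul (by positivity) (by positivity),
      Real.log_pow, Real.log_pow, Real.log_pow, Real.log_pow, Real.log_pow, Real.log_pow, Real.log_pow]
  have hloglr : Real.log (E ^ (∑ x ∈ range L, x)) ≤
      Real.log (Λ ^ (D - 1) * Mβ ^ (L * S) * (ν : ℝ) ^ (L * S) *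
        (2 ^ L * (L : ℝ) ^ L * 𝔐 ^ L * E ^ (L * S))) :=
    Real.log_le_log (by positivity) hcomb
  rw [hlogLHS, hlogRHS, hlogΛ, hlog𝔓, hlog𝔐] at hloglr
  -- the elementary comparisons
  have hD1 : 1 ≤ D := natDegree_pos_of_aeval_root hQ0 hβQ (fun x hx => by
    rwa [algebraMap_int_eq, eq_intCast, Int.cast_eq_zero] at hx)
  have hD1r : ((D - 1 : ℕ) : ℝ) = (D : ℝ) - 1 := by rw [Nat.cast_sub hD1, Nat.cast_one]
  have hLSr : ((L * S : ℕ) : ℝ) = (L : ℝ) * S := by push_cast; ring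
  rw [hD1r, hLSr] at hloglr
  have hDr1 : (D : ℝ) - 1 ≤ Dr - 1 := by linarith
  have hD0 : (0 : ℝ) ≤ (D : ℝ) - 1 := by
    have : (1 : ℝ) ≤ D := by exact_mod_cast hD1
    linarith
  have hlogL0 : 0 ≤ Real.log (L : ℝ) := Real.log_nonneg (by exact_mod_cast hL1)
  have hlogν0 : 0 ≤ Real.log (ν : ℝ) := Real.log_nonneg hνr
  have hlogT₁0 : 0 ≤ Real.log (T₁ : ℝ) := Real.log_nonneg hT₁r
  have hSlogS0 : 0 ≤ (S : ℝ) * Real.log S := by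
    rcases Nat.eq_zero_or_pos S with h | h
    · subst h; simp
    · exact mul_nonneg (Nat.cast_nonneg _) (Real.log_nonneg (by exact_mod_cast h))
  have hlogb0 : 0 ≤ Real.log (1 + (S₁ : ℝ) / H) := Real.log_nonneg (by
    have : (0 : ℝ) ≤ (S₁ : ℝ) / H := by positivity
    linarith)
  have hS0 : (0 : ℝ) ≤ S := Nat.cast_nonneg _
  have hT0 : (0 : ℝ) ≤ T := Nat.cast_nonneg _
  have hL0 : (0 : ℝ) ≤ L := Nat.cast_nonneg _
  -- `log 𝔓 ≤ B𝔓 := S lν + S log T₁ + S log S + (T+H) + T log(1 + S₁/H)` and `0 ≤ log 𝔓`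
  set B𝔓 : ℝ := S * lν + S * Real.log T₁ + S * Real.log S + ((T : ℝ) + H) +
    T * Real.log (1 + (S₁ : ℝ) / H) with hB𝔓
  have hlog𝔓le : S * Real.log ν + S * Real.log T₁ + S * Real.log S + ((T : ℝ) + H) +
      T * Real.log (1 + (S₁ : ℝ) / H) ≤ B𝔓 := by
    rw [hB𝔓]
    have := mul_le_mul_of_nonneg_left hlν hS0
    linarith only [this]
  have hlog𝔓0 : 0 ≤ S * Real.log ν + S * Real.log T₁ + S * Real.log S + ((T : ℝ) + H) +
      T * Real.log (1 + (S₁ : ℝ) / H) := by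
    have h1 := mul_nonneg hS0 hlogν0
    have h2 := mul_nonneg hS0 hlogT₁0
    have h3 := mul_nonneg hT0 hlogb0
    have h4 : (0 : ℝ) ≤ H := Nat.cast_nonneg _
    linarith only [h1, h2, h3, h4, hSlogS0, hT0]
  -- `(D-1)(L log L + L log 𝔓) ≤ (Dr-1)(L log L + L B𝔓)`
  have hbr0 : 0 ≤ (L : ℝ) * Real.log L + L * (S * Real.log ν + S * Real.log T₁ + S * Real.log S +
      ((T : ℝ) + H) + T * Real.log (1 + (S₁ : ℝ) / H)) := by
    have h1 := mul_nonneg hL0 hlog𝔓0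
    have h2 := mul_nonneg hL0 hlogL0
    linarith only [h1, h2]
  have hstep1 : ((D : ℝ) - 1) * ((L : ℝ) * Real.log L + L * (S * Real.log ν + S * Real.log T₁ +
      S * Real.log S + ((T : ℝ) + H) + T * Real.log (1 + (S₁ : ℝ) / H))) ≤
      (Dr - 1) * ((L : ℝ) * Real.log L + L * B𝔓) := by
    calc ((D : ℝ) - 1) * ((L : ℝ) * Real.log L + L * (S * Real.log ν + S * Real.log T₁ +
          S * Real.log S + ((T : ℝ) + H) + T * Real.log (1 + (S₁ : ℝ) / H)))
        ≤ (Dr - 1) * ((L : ℝ) * Real.log L + L * (S * Real.log ν + S * Real.log T₁ +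
          S * Real.log S + ((T : ℝ) + H) + T * Real.log (1 + (S₁ : ℝ) / H))) :=
          mul_le_mul_of_nonneg_right hDr1 hbr0
      _ ≤ (Dr - 1) * ((L : ℝ) * Real.log L + L * B𝔓) := by
          refine mul_le_mul_of_nonneg_left ?_ (le_trans hD0 hDr1)
          have := mul_le_mul_of_nonneg_left hlog𝔓le hL0
          linarith only [this]
  have hstep2 : (L : ℝ) * S * Real.log Mβ ≤ L * S * Hβ :=
    mul_le_mul_of_nonneg_left hHβ (by positivity)
  have hstep3 : (L : ℝ) * S * Real.log ν ≤ L * S * lν :=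
    mul_le_mul_of_nonneg_left hlν (by positivity)
  have hstep4 : (L : ℝ) * Real.log L ≤ Dr * L * Real.log L - ((D : ℝ) - 1) * (L * Real.log L) := by
    have : (D : ℝ) * (L * Real.log L) ≤ Dr * (L * Real.log L) :=
      mul_le_mul_of_nonneg_right hDr (mul_nonneg hL0 hlogL0)
    have e1 : (D : ℝ) * (L * Real.log L) = ((D : ℝ) - 1) * (L * Real.log L) + L * Real.log L := by ring
    have e2 : Dr * (L * Real.log L) = Dr * L * Real.log L := by ring
    linarith only [this, e1, e2]
  -- combine
  have hfinal : (L : ℝ) * ((L : ℝ) - 1) / 2 * Real.log E ≤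
      (L : ℝ) * Real.log 2 + Dr * L * Real.log L + (Dr - 1) * L * B𝔓 +
        L * S * Hβ + L * S * lν +
        L * (S * Real.log S + ((T : ℝ) + H) + T * Real.log (1 + E * S₁ / H) +
          S * Real.log (Real.pi * T₁) + Real.pi * T₁ * (E * S₁)) +
        L * S * Real.log E := by
    linarith only [hloglr, hstep1, hstep2, hstep3, hstep4]
  rw [hB𝔓] at hfinal
  linarith only [hfinal, hmain]

end NWPi

end Literature.NumberTheory.Transcendental

end
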